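import Summits.CriticalPhenomena.SAWScalingLimit.Theses.SAWDefectDecoherence
import Literature.Probability.RandomPlanarGeometry.HexSAWLattice
import Literature.Probability.RandomPlanarGeometry.HexParafermionProofs
import Literature.Probability.RandomPlanarGeometry.RectangleConformalMap
import Literature.Probability.RandomPlanarGeometry.HexSAWLemma2

/-!
# Crux `MassRatio` (stmt-CriticalPhenomena-8550) — load-bearing hypotheses, part 1: brick coordinates `row/pos/bv` on the honeycomb lattice, the embedding in coordinates, linkage (`Linked`) along runs and vertical bands

Negative knowledge on the crux `MassRatio` (stmt-CriticalPhenomena-8550, route SAWDefectDecoherence r3),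
written by the standing disprover (cdisprove, cycles 1–4). The series `MassRatio/Negative/*` does NOT
refute the crux (verdict: RESISTS — it is a pure exponent bet, predicted ratio `δ^{-25/48}` against the
cut `δ^{-3/4}`); it proves which hypotheses of the crux are LOAD-BEARING (rows clause, `0 < ρ`,
`δ·mid(b_δ) → b`, exhaustion of compacts: each deleted ⇒ FALSE, by explicit admissible families in the
rectangle `D₀ = (-2,2)×(-1,1)` whose boundary mass at the target edge is starved EXACTLY by a bare
corridor), that the hypothesis frame is satisfiable (`massRatio_frame_nonvacuous`), and that the
`Nonempty`-SAW clause is implied by the others. Mechanism throughout: on a bare root-attached corridor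
the self-avoiding walk is unique, so `|Z| = x_c^{length}` exactly, while a staircase walk certifies
`|Z(e₀)| ≥ x_c^{2 iK + 1}` at a mid-edge `e₀` of the compact `Kbox`; `x_c < 3/5` and Bernoulli finish.
-/

namespace Summit.CriticalPhenomena.SAWScalingLimit.Theorems.MassRatio.Negative

open Literature.Probability.LatticeModels Literature.Probability.RandomPlanarGeometry.SAW
open Literature.Probability.RandomPlanarGeometry
open Summit.CriticalPhenomena.SAWScalingLimit.Theses.SAWDefectDecoherence

/-! ## §A. Brick coordinates on the honeycomb lattice -/

/-- `row`: brick-coordinate / linkage toolkit on the honeycomb lattice (MassRatio negative series). [folklore] -/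
def row (v : HexVertex) : ℤ := v.1 1
/-- `pos`: brick-coordinate / linkage toolkit on the honeycomb lattice (MassRatio negative series). [folklore] -/
def pos (v : HexVertex) : ℤ := 2 * v.1 0 + v.1 1 + ((v.2 : ℕ) : ℤ)
/-- `bv`: brick-coordinate / linkage toolkit on the honeycomb lattice (MassRatio negative series). [folklore] -/
def bv (r p : ℤ) : HexVertex :=
  (![(p - r - (p - r) % 2) / 2, r], if (p - r) % 2 = 0 then 0 else 1)
/-- `row_bv`: brick-coordinate / linkage toolkit on the honeycomb lattice (MassRatio negative series). [folklore] -/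
@[simp] theorem row_bv (r p : ℤ) : row (bv r p) = r := by simp [row, bv]
/-- `pos_bv`: brick-coordinate / linkage toolkit on the honeycomb lattice (MassRatio negative series). [folklore] -/
theorem pos_bv (r p : ℤ) : pos (bv r p) = p := by
  unfold pos bv
  have h2 : (p - r) % 2 = 0 ∨ (p - r) % 2 = 1 := by omega
  rcases h2 with h | h
  · simp [h]; omega
  · simp [h]; omega
/-- `bv_row_pos`: brick-coordinate / linkage toolkit on the honeycomb lattice (MassRatio negative series). [folklore] -/
theorem bv_row_pos (v : HexVertex) : bv (row v) (pos v) = v := by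
  obtain ⟨x, k⟩ := v
  have hk : k = 0 ∨ k = 1 := by
    rcases k with ⟨k, hk⟩
    have : k = 0 ∨ k = 1 := by omega
    rcases this with rfl | rfl
    · exact Or.inl rfl
    · exact Or.inr rfl
  refine Prod.ext ?_ ?_
  · funext j
    fin_cases j
    · rcases hk with rfl | rfl
      · simp [bv, row, pos]
      · simp [bv, row, pos]
        omega
    · rcases hk with rfl | rfl <;> simp [bv, row, pos]
  · rcases hk with rfl | rfl
    · simp [bv, row, pos]
    · simp [bv, row, pos]
      omega

/-- `bv_inj`: brick-coordinate / linkage toolkit on the honeycomb lattice (MassRatio negative series). [folklore] -/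
theorem bv_inj {r p r' p' : ℤ} (h : bv r p = bv r' p') : r = r' ∧ p = p' := by
  have h1 := congrArg row h
  have h2 := congrArg pos h
  simp only [row_bv, pos_bv] at h1 h2
  exact ⟨h1, h2⟩

/-- `adj_iff`: brick-coordinate / linkage toolkit on the honeycomb lattice (MassRatio negative series). [folklore] -/
theorem adj_iff (u v : HexVertex) :
    hexGraph.Adj u v ↔
      (row u = row v ∧ (pos v = pos u + 1 ∨ pos v = pos u - 1)) ∨
      (pos u = pos v ∧ row v = row u - 1 ∧ (pos u - row u) % 2 = 0) ∨
      (pos u = pos v ∧ row v = row u + 1 ∧ (pos u - row u) % 2 = 1) := by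
  obtain ⟨x, i⟩ := u
  obtain ⟨y, j⟩ := v
  rw [hexGraph_adj_iff_coord]
  unfold row pos
  fin_cases i <;> fin_cases j <;> simp <;> omega
/-- `adj_bv_iff`: brick-coordinate / linkage toolkit on the honeycomb lattice (MassRatio negative series). [folklore] -/
theorem adj_bv_iff (r p r' p' : ℤ) :
    hexGraph.Adj (bv r p) (bv r' p') ↔
      (r = r' ∧ (p' = p + 1 ∨ p' = p - 1)) ∨
      (p = p' ∧ r' = r - 1 ∧ (p - r) % 2 = 0) ∨
      (p = p' ∧ r' = r + 1 ∧ (p - r) % 2 = 1) := by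
  rw [adj_iff]; simp only [row_bv, pos_bv]

/-! ### Geometry of the embedding in brick coordinates -/

/-- `hexCenter_re`: brick-coordinate / linkage toolkit on the honeycomb lattice (MassRatio negative series). [folklore] -/
theorem hexCenter_re (v : HexVertex) : (hexCenter v).re = ((pos v : ℝ) + 1) / 2 := by
  obtain ⟨x, k⟩ := v
  simp only [hexCenter, triEmbed, pos, Complex.add_re, Complex.mul_re, Complex.intCast_re,
    Complex.intCast_im, triZeta_re, triZeta_im, Complex.div_re, Complex.one_re,
    Complex.one_im, Complex.add_im]
  fin_cases k <;> simp <;> ring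

/-- `hexCenter_im`: brick-coordinate / linkage toolkit on the honeycomb lattice (MassRatio negative series). [folklore] -/
theorem hexCenter_im (v : HexVertex) :
    (hexCenter v).im = Real.sqrt 3 / 2 * ((row v : ℝ) + (((v.2 : ℕ) : ℝ) + 1) / 3) := by
  obtain ⟨x, k⟩ := v
  simp only [hexCenter, triEmbed, row, Complex.add_im, Complex.mul_im, Complex.intCast_re,
    Complex.intCast_im, triZeta_re, triZeta_im, Complex.div_im, Complex.one_re,
    Complex.one_im, Complex.add_re]
  fin_cases k <;> simp <;> ring

/-- `hexCenter_im_ge`: brick-coordinate / linkage toolkit on the honeycomb lattice (MassRatio negative series). [folklore] -/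
theorem hexCenter_im_ge (v : HexVertex) :
    Real.sqrt 3 / 2 * ((row v : ℝ) + 1 / 3) ≤ (hexCenter v).im := by
  rw [hexCenter_im]
  have h3 : (0:ℝ) ≤ Real.sqrt 3 / 2 := by positivity
  have hk : (0:ℝ) ≤ ((v.2 : ℕ) : ℝ) := by positivity
  apply mul_le_mul_of_nonneg_left _ h3
  linarith

/-- `hexCenter_im_le`: brick-coordinate / linkage toolkit on the honeycomb lattice (MassRatio negative series). [folklore] -/
theorem hexCenter_im_le (v : HexVertex) :
    (hexCenter v).im ≤ Real.sqrt 3 / 2 * ((row v : ℝ) + 2 / 3) := by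
  rw [hexCenter_im]
  have h3 : (0:ℝ) ≤ Real.sqrt 3 / 2 := by positivity
  have hk : ((v.2 : ℕ) : ℝ) ≤ 1 := by
    have : (v.2 : ℕ) ≤ 1 := by have := v.2.isLt; omega
    exact_mod_cast this
  apply mul_le_mul_of_nonneg_left _ h3
  linarith

/-- midpoint of a horizontal edge (same row `r`, positions `p`, `p+1`). [folklore] -/
theorem hexMidpoint_bv_horiz_re (r p : ℤ) :
    (hexMidpoint s(bv r p, bv r (p + 1))).re = ((p : ℝ) + 3 / 2) / 2 := by
  rw [hexMidpoint_mk, Complex.div_re, Complex.add_re, hexCenter_re, hexCenter_re, pos_bv, pos_bv]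
  simp; ring

/-! ### Linkage inside an induced subgraph -/

/-- `u` and `v` lie in `S` and are joined by a path of the honeycomb lattice inside `S`. [folklore] -/
def Linked (S : Set HexVertex) (u v : HexVertex) : Prop :=
  ∃ (hu : u ∈ S) (hv : v ∈ S), (hexGraph.induce S).Reachable ⟨u, hu⟩ ⟨v, hv⟩

/-- `Linked.refl`: brick-coordinate / linkage toolkit on the honeycomb lattice (MassRatio negative series). [folklore] -/
theorem Linked.refl {S : Set HexVertex} {u : HexVertex} (hu : u ∈ S) : Linked S u u :=
  ⟨hu, hu, SimpleGraph.Reachable.refl _⟩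

/-- `Linked.symm`: brick-coordinate / linkage toolkit on the honeycomb lattice (MassRatio negative series). [folklore] -/
theorem Linked.symm {S : Set HexVertex} {u v : HexVertex} (h : Linked S u v) : Linked S v u := by
  obtain ⟨hu, hv, h⟩ := h
  exact ⟨hv, hu, h.symm⟩

/-- `Linked.trans`: brick-coordinate / linkage toolkit on the honeycomb lattice (MassRatio negative series). [folklore] -/
theorem Linked.trans {S : Set HexVertex} {u v w : HexVertex} (h₁ : Linked S u v)
    (h₂ : Linked S v w) : Linked S u w := by
  obtain ⟨hu, hv, h₁⟩ := h₁
  obtain ⟨hv', hw, h₂⟩ := h₂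
  exact ⟨hu, hw, h₁.trans h₂⟩

/-- `linked_of_adj`: brick-coordinate / linkage toolkit on the honeycomb lattice (MassRatio negative series). [folklore] -/
theorem linked_of_adj {S : Set HexVertex} {u v : HexVertex} (hu : u ∈ S) (hv : v ∈ S)
    (h : hexGraph.Adj u v) : Linked S u v :=
  ⟨hu, hv, SimpleGraph.Adj.reachable (by simpa [SimpleGraph.comap_adj] using h)⟩

/-- `Linked.mono`: brick-coordinate / linkage toolkit on the honeycomb lattice (MassRatio negative series). [folklore] -/
theorem Linked.mono {S T : Set HexVertex} {u v : HexVertex} (hST : S ⊆ T) (h : Linked S u v) :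
    Linked T u v := by
  obtain ⟨hu, hv, h⟩ := h
  exact ⟨hST hu, hST hv, h.map (SimpleGraph.induceHomOfLE hexGraph hST).toHom⟩

/-- `Linked.mem_left`: brick-coordinate / linkage toolkit on the honeycomb lattice (MassRatio negative series). [folklore] -/
theorem Linked.mem_left {S : Set HexVertex} {u v : HexVertex} (h : Linked S u v) : u ∈ S := h.1
/-- `Linked.mem_right`: brick-coordinate / linkage toolkit on the honeycomb lattice (MassRatio negative series). [folklore] -/
theorem Linked.mem_right {S : Set HexVertex} {u v : HexVertex} (h : Linked S u v) : v ∈ S := h.2.1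

/-- `preconnected_of_linked`: brick-coordinate / linkage toolkit on the honeycomb lattice (MassRatio negative series). [folklore] -/
theorem preconnected_of_linked {S : Set HexVertex}
    (h : ∀ u ∈ S, ∀ v ∈ S, Linked S u v) : (hexGraph.induce S).Preconnected := by
  rintro ⟨u, hu⟩ ⟨v, hv⟩
  obtain ⟨_, _, h⟩ := h u hu v hv
  exact h

/-- A horizontal run inside `S`. [folklore] -/
theorem linked_run {S : Set HexVertex} (r p : ℤ) (n : ℕ)
    (h : ∀ i : ℕ, i ≤ n → bv r (p + i) ∈ S) : Linked S (bv r p) (bv r (p + n)) := by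
  induction n with
  | zero => simpa using Linked.refl (h 0 le_rfl)
  | succ n ih =>
    have h1 : Linked S (bv r p) (bv r (p + n)) := ih fun i hi => h i (by omega)
    refine h1.trans (linked_of_adj (h n (by omega)) ?_ ?_)
    · have := h (n + 1) le_rfl
      simpa [Nat.cast_succ, add_assoc] using this
    · rw [adj_bv_iff]; left; exact ⟨rfl, Or.inl (by push_cast; ring)⟩

/-- A horizontal run inside `S`, integer form: from position `p` to position `q ≥ p`. [folklore] -/
theorem linked_run' {S : Set HexVertex} (r p q : ℤ) (hpq : p ≤ q)
    (h : ∀ t : ℤ, p ≤ t → t ≤ q → bv r t ∈ S) : Linked S (bv r p) (bv r q) := by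
  obtain ⟨n, rfl⟩ : ∃ n : ℕ, q = p + n := ⟨(q - p).toNat, by omega⟩
  exact linked_run r p n fun i hi => h _ (by omega) (by omega)

/-- One step down inside the band `{q, q+1}`: rows `r` and `r-1` of the band in `S`. [folklore] -/
theorem linked_band_down {S : Set HexVertex} (r q : ℤ)
    (h0 : bv r q ∈ S) (h1 : bv r (q + 1) ∈ S) (h2 : bv (r - 1) q ∈ S) (h3 : bv (r - 1) (q + 1) ∈ S) :
    Linked S (bv r q) (bv (r - 1) q) := by
  have hq : (q - r) % 2 = 0 ∨ (q + 1 - r) % 2 = 0 := by omega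
  rcases hq with hq | hq
  · exact linked_of_adj h0 h2 (by rw [adj_bv_iff]; right; left; exact ⟨rfl, rfl, hq⟩)
  · have a1 : Linked S (bv r q) (bv r (q + 1)) :=
      linked_of_adj h0 h1 (by rw [adj_bv_iff]; left; exact ⟨rfl, Or.inl rfl⟩)
    have a2 : Linked S (bv r (q + 1)) (bv (r - 1) (q + 1)) :=
      linked_of_adj h1 h3 (by rw [adj_bv_iff]; right; left; exact ⟨rfl, rfl, hq⟩)
    have a3 : Linked S (bv (r - 1) (q + 1)) (bv (r - 1) q) :=
      linked_of_adj h3 h2 (by rw [adj_bv_iff]; left; exact ⟨rfl, Or.inr (by ring)⟩)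
    exact (a1.trans a2).trans a3

/-- Descending `n` rows inside the band `{q, q+1}`. [folklore] -/
theorem linked_band_descend {S : Set HexVertex} (r q : ℤ) (n : ℕ)
    (h : ∀ i : ℕ, i ≤ n → bv (r - i) q ∈ S ∧ bv (r - i) (q + 1) ∈ S) :
    Linked S (bv r q) (bv (r - n) q) := by
  induction n with
  | zero => simpa using Linked.refl (h 0 le_rfl).1
  | succ n ih =>
    have h1 : Linked S (bv r q) (bv (r - n) q) := ih fun i hi => h i (by omega)
    have step := linked_band_down (S := S) (r - n) q (h n (by omega)).1 (h n (by omega)).2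
      (by have := (h (n+1) le_rfl).1; convert this using 2; push_cast; ring)
      (by have := (h (n+1) le_rfl).2; convert this using 2; push_cast; ring)
    refine h1.trans ?_
    convert step using 2; push_cast; ring

/-- Vertical linkage inside a band `{q, q+1} × [r₁, r₂] ⊆ S`: from row `r₂` down to row `r₁`. [folklore] -/
theorem linked_band {S : Set HexVertex} (q r₁ r₂ : ℤ) (h12 : r₁ ≤ r₂)
    (h : ∀ r : ℤ, r₁ ≤ r → r ≤ r₂ → bv r q ∈ S ∧ bv r (q + 1) ∈ S) :
    Linked S (bv r₂ q) (bv r₁ q) := by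
  obtain ⟨n, rfl⟩ : ∃ n : ℕ, r₁ = r₂ - n := ⟨(r₂ - r₁).toNat, by omega⟩
  exact linked_band_descend r₂ q n fun i hi => h _ (by omega) (by
    have : (0:ℤ) ≤ i := by positivity
    linarith)

end Summit.CriticalPhenomena.SAWScalingLimit.Theorems.MassRatio.Negative
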